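import Mathlib
import Summits.NavierStokesRegularity.NavierStokesRegularity.Theorems.PicardRadiiRungThreeRadiiGlueRStage
import HarnessLib

/-!
# `PicardRadiiRungThree.RadiiGlueR` (item stmt-NavierStokesRegularity-23947) — the EPOCH clause of one
  stage from its Newton–Kantorovich data

Route `PicardRadiiRungThree` (rung TL-M3 of the Tao ladder; MODEL lattice ODEs only). `stage_epoch`:
for one stage of the certificate `PicardRadiiCertificateR` and one entry state `q` of its box, the
Newton–Kantorovich clause at `σ = 0` gives a Picard path `P` within `r₁` of the approximate orbit, hence
(`orbit_of_intEq`) an exact window trajectory `x` of the truncated cascade from `q`; the margin clause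
puts it `mm` inside the reduced sup bounds; the level bracket `T₁ ≤ T₂` and the intermediate value
theorem on `|x_{i₀,1}|` give the crossing time `τq ∈ [T₁ τs, T₂ τs]` with `|x_{i₀,1}(τq)| = L ≥ as`; the
section clause at `e = P̃(τq/τs)` gives exit and landing; `tube_of_nk` gives the TUBE clause. This is
exactly the EPOCH clause of `ExactFlowCertificateR` for that stage and entry.

HONEST FRAMING: bookkeeping about Tao-type MODEL lattice ODEs; nothing here is a statement about the
Navier–Stokes equations; NS regularity is NOT proved by anything in this file.
-/

noncomputable section

-- the sub-problem namespace repeats the summit name by design (D-0017)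
set_option linter.dupNamespace false

namespace Summit.NavierStokesRegularity.NavierStokesRegularity.Theorems

open Set Metric Function MeasureTheory intervalIntegral Literature.Analysis.FluidPDE
  Literature.Analysis.FluidPDE.TaoCascade

namespace RadiiGlueR

variable {Kb Ka : ℤ}

/-- **The EPOCH clause of one stage from its Newton–Kantorovich data** (see the module docstring;
`Sec w a` abstracts the exit-and-landing clauses evaluated at the crossing state `w` with normaliser
`a`). [cite: Tao2016AveragedNS, §4 (4.8) (the truncated window system); ConstantineauGarciaAzpeitiaLessard2021, Thm. 3.1] -/
theorem stage_epoch (α : Fin 4 → Fin 4 → Fin 4 → ℤ × ℤ × ℤ → ℝ) {ω : ℤ → ℝ} (hω : ∀ k, 0 < ω k)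
    (fE : (Fin 4 → ↥(Finset.Icc (-Kb) Ka) → ℝ) → Fin 4 → ℤ → ℝ)
    (hfE1 : ∀ e i n (h : -Kb ≤ n ∧ n ≤ Ka), fE e i n = e i ⟨n, Finset.mem_Icc.mpr h⟩)
    (hfE0 : ∀ e i n, ¬ (-Kb ≤ n ∧ n ≤ Ka) → fE e i n = 0)
    (Q : (Fin 4 → ↥(Finset.Icc (-Kb) Ka) → ℝ) → (Fin 4 → ↥(Finset.Icc (-Kb) Ka) → ℝ))
    (hQ : ∀ e i (k : ↥(Finset.Icc (-Kb) Ka)),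
      Q e i k = quadTerm 1 α (fun j' n (_ : ℝ) => ω n * fE e j' n) i k 0 / ω k)
    (hQc : Continuous Q)
    (xb : ℝ → (Fin 4 → ↥(Finset.Icc (-Kb) Ka) → ℝ) →
      C(↥(Icc (0 : ℝ) 1), Fin 4 → ↥(Finset.Icc (-Kb) Ka) → ℝ))
    (G : ℝ → (Fin 4 → ↥(Finset.Icc (-Kb) Ka) → ℝ) →
      C(↥(Icc (0 : ℝ) 1), Fin 4 → ↥(Finset.Icc (-Kb) Ka) → ℝ) →
      C(↥(Icc (0 : ℝ) 1), Fin 4 → ↥(Finset.Icc (-Kb) Ka) → ℝ))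
    (G' : ℝ → C(↥(Icc (0 : ℝ) 1), Fin 4 → ↥(Finset.Icc (-Kb) Ka) → ℝ) →
      (C(↥(Icc (0 : ℝ) 1), Fin 4 → ↥(Finset.Icc (-Kb) Ka) → ℝ) →L[ℝ]
        C(↥(Icc (0 : ℝ) 1), Fin 4 → ↥(Finset.Icc (-Kb) Ka) → ℝ)))
    (A : ℝ → (Fin 4 → ↥(Finset.Icc (-Kb) Ka) → ℝ) →
      (C(↥(Icc (0 : ℝ) 1), Fin 4 → ↥(Finset.Icc (-Kb) Ka) → ℝ) →L[ℝ]
        C(↥(Icc (0 : ℝ) 1), Fin 4 → ↥(Finset.Icc (-Kb) Ka) → ℝ)))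
    {τs Y₀ Z Λ r₁ r₂ κ δ mm T₁ T₂ L as : ℝ} {M : ℤ → ℝ} {i₀ : Fin 4}
    (hG : ∀ σ z (p : C(↥(Icc (0 : ℝ) 1), Fin 4 → ↥(Finset.Icc (-Kb) Ka) → ℝ)) (t : ↥(Icc (0 : ℝ) 1)),
      (G σ z p) t = p t - z - ((1 - σ) * τs) • ∫ u in (0 : ℝ)..(t : ℝ), Q (IccExtend zero_le_one p u))
    (NK : ℝ → (Fin 4 → ↥(Finset.Icc (-Kb) Ka) → ℝ) → Prop)
    (hNK : ∀ σ z, NK σ z → Injective (A σ z) ∧ ‖A σ z (G σ z (xb σ z))‖ ≤ Y₀ ∧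
      ‖A σ z‖ ≤ Λ * (1 - Z) ∧
      (∀ x, ‖x - xb σ z‖ ≤ r₂ → HasFDerivAt (G σ z) (G' σ x) x ∧
        ‖ContinuousLinearMap.id ℝ _ - (A σ z).comp (G' σ x)‖ ≤ Z) ∧
      ∀ (t : ℝ) (i : Fin 4) (k : ℤ), -Kb ≤ k → k ≤ Ka →
        ω k * (|fE (IccExtend zero_le_one (xb σ z) t) i k| + r₂) ≤ M k)
    (hτs : 0 < τs) (hr : r₁ ≤ r₂) (hZ1 : Z < 1) (hp : Y₀ + Z * r₁ ≤ r₁) (hκ : 0 ≤ κ)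
    (hKa : 1 ≤ Ka) (hKb : 0 ≤ Kb) (hT₁ : 0 < T₁) (hT₁₂ : T₁ ≤ T₂) (hT₂ : T₂ ≤ 1) (hasL : as ≤ L)
    (Sec : (Fin 4 → ℤ → ℝ) → ℝ → Prop)
    (q : Fin 4 → ℤ → ℝ) (zq : Fin 4 → ↥(Finset.Icc (-Kb) Ka) → ℝ)
    (hzq : ∀ (i : Fin 4) (k : ↥(Finset.Icc (-Kb) Ka)), zq i k = q i k / ω k)
    (hNK0 : NK 0 zq)
    (hmarg : ∀ (t : ℝ) (i : Fin 4) (k : ℤ), -Kb ≤ k → k ≤ Ka →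
      ω k * (|fE (IccExtend zero_le_one (xb 0 zq) t) i k| + r₁) ≤ M k - Λ * δ * τs * ω k - mm)
    (htube : ∀ σ ∈ Icc (0 : ℝ) 1, ∀ z z' : Fin 4 → ↥(Finset.Icc (-Kb) Ka) → ℝ,
      ‖z - IccExtend zero_le_one (xb 0 zq) σ‖ ≤ κ + r₁ →
      ‖z' - IccExtend zero_le_one (xb 0 zq) σ‖ ≤ κ + r₁ → NK σ z ∧ ‖xb σ z - xb σ z'‖ + r₁ ≤ r₂)
    (hlev₁ : ω 1 * (|fE (IccExtend zero_le_one (xb 0 zq) T₁) i₀ 1| + r₁) ≤ L)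
    (hlev₂ : L + ω 1 * r₁ ≤ ω 1 * |fE (IccExtend zero_le_one (xb 0 zq) T₂) i₀ 1|)
    (hsec : ∀ σ ∈ Icc T₁ T₂, ∀ e : Fin 4 → ↥(Finset.Icc (-Kb) Ka) → ℝ,
      ‖e - IccExtend zero_le_one (xb 0 zq) σ‖ ≤ r₁ → |ω 1 * fE e i₀ 1| = L →
      Sec (fun i n => ω n * fE e i n) L) :
    ∃ (τq : ℝ) (x : Fin 4 → ℤ → ℝ → ℝ), 0 < τq ∧ τq ≤ τs ∧ as ≤ |x i₀ 1 τq| ∧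
      (∀ i k, -Kb ≤ k → k ≤ Ka → x i k 0 = q i k ∧ ∀ t ∈ Icc 0 τq,
        HasDerivWithinAt (x i k)
          (quadTerm 1 α (fun j' n s' => if -Kb ≤ n ∧ n ≤ Ka then x j' n s' else 0) i k t) (Icc 0 τq) t ∧
        |x i k t| ≤ M k - Λ * δ * τs * ω k - mm) ∧
      Sec (fun i n => x i n τq) |x i₀ 1 τq| ∧
      (∀ t ∈ Icc 0 τq, ∀ (z z' : Fin 4 → ℤ → ℝ) (d u : ℝ),
        (∀ i k, -Kb ≤ k → k ≤ Ka →
          |z i k - x i k t| ≤ κ * ω k ∧ |z' i k - x i k t| ≤ κ * ω k ∧ |z i k - z' i k| ≤ d * ω k) →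
        0 < u → t + u ≤ τq →
        ∃ y y' : Fin 4 → ℤ → ℝ → ℝ, ∀ i k, -Kb ≤ k → k ≤ Ka → y i k 0 = z i k ∧ y' i k 0 = z' i k ∧
          ∀ t' ∈ Icc 0 u,
            HasDerivWithinAt (y i k)
              (quadTerm 1 α (fun j' n s' => if -Kb ≤ n ∧ n ≤ Ka then y j' n s' else 0) i k t')
              (Icc 0 u) t' ∧
            HasDerivWithinAt (y' i k)
              (quadTerm 1 α (fun j' n s' => if -Kb ≤ n ∧ n ≤ Ka then y' j' n s' else 0) i k t')
              (Icc 0 u) t' ∧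
            |y i k t'| ≤ M k ∧ |y' i k t'| ≤ M k ∧ |y i k t' - y' i k t'| ≤ Λ * d * ω k) := by
  -- the zero at σ = 0 and the orbit from q
  obtain ⟨hA0, hY0, -, hball0, -⟩ := hNK 0 zq hNK0
  obtain ⟨P, hP0, hPr⟩ := exists_zero_of_nk hA0 hY0 hball0 hr hZ1 hp
  have hint : ∀ t : ↥(Icc (0 : ℝ) 1), P t = zq + τs •
      ∫ u in (0 : ℝ)..(t : ℝ), Q (IccExtend zero_le_one P u) := by
    intro t
    have := intEq_of_zero Q G hG hP0 t
    simpa using this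
  set x : Fin 4 → ℤ → ℝ → ℝ := fun i n s' => ω n * fE (IccExtend zero_le_one P (s' / τs)) i n with hx
  have hO := orbit_of_intEq α hω fE hfE1 hfE0 Q hQ hQc hτs hint x (fun i n s' => rfl)
  have h1mem : -Kb ≤ (1 : ℤ) ∧ (1 : ℤ) ≤ Ka := ⟨by linarith, hKa⟩
  -- closeness of the unscaled orbit to the unscaled approximate orbit
  have hnear : ∀ (i : Fin 4) (n : ℤ) (s' : ℝ),
      |x i n s' - ω n * fE (IccExtend zero_le_one (xb 0 zq) (s' / τs)) i n| ≤ ω n * r₁ := fun i n s' =>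
    (hO.2.2 (xb 0 zq) i n s').trans (mul_le_mul_of_nonneg_left hPr (hω n).le)
  -- the crossing time by the intermediate value theorem
  have hcont : Continuous fun s' => |x i₀ 1 s'| := by
    have hc : Continuous fun s' : ℝ => (IccExtend zero_le_one P (s' / τs)) i₀ ⟨1, Finset.mem_Icc.mpr h1mem⟩ :=
      (continuous_apply _).comp ((continuous_apply i₀).comp
        ((P.continuous.Icc_extend').comp (continuous_id.div_const τs)))
    have heq : (fun s' => |x i₀ 1 s'|) =
        fun s' => |ω 1 * (IccExtend zero_le_one P (s' / τs)) i₀ ⟨1, Finset.mem_Icc.mpr h1mem⟩| := by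
      funext s'; rw [hx]; simp only [hfE1 _ i₀ 1 h1mem]
    rw [heq]
    exact (continuous_const.mul hc).abs
  have habsω : ∀ (T : ℝ), |ω 1 * fE (IccExtend zero_le_one (xb 0 zq) T) i₀ 1| =
      ω 1 * |fE (IccExtend zero_le_one (xb 0 zq) T) i₀ 1| := fun T => by
    rw [abs_mul, abs_of_pos (hω 1)]
  have hgT₁ : |x i₀ 1 (T₁ * τs)| ≤ L := by
    have h1 := hnear i₀ 1 (T₁ * τs)
    rw [mul_div_cancel_right₀ _ hτs.ne'] at h1
    have h2 := abs_sub_abs_le_abs_sub (x i₀ 1 (T₁ * τs))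
      (ω 1 * fE (IccExtend zero_le_one (xb 0 zq) T₁) i₀ 1)
    have h3 := habsω T₁
    linarith
  have hgT₂ : L ≤ |x i₀ 1 (T₂ * τs)| := by
    have h1 := hnear i₀ 1 (T₂ * τs)
    rw [mul_div_cancel_right₀ _ hτs.ne'] at h1
    have h2 := abs_sub_abs_le_abs_sub (ω 1 * fE (IccExtend zero_le_one (xb 0 zq) T₂) i₀ 1)
      (x i₀ 1 (T₂ * τs))
    rw [abs_sub_comm] at h2
    have h3 := habsω T₂
    linarith
  have hTT : T₁ * τs ≤ T₂ * τs := mul_le_mul_of_nonneg_right hT₁₂ hτs.le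
  obtain ⟨τq, hτqI, hτqL⟩ : ∃ τq ∈ Icc (T₁ * τs) (T₂ * τs), |x i₀ 1 τq| = L :=
    intermediate_value_Icc hTT hcont.continuousOn ⟨hgT₁, hgT₂⟩
  have hτq0 : 0 < τq := lt_of_lt_of_le (mul_pos hT₁ hτs) hτqI.1
  have hτqs : τq ≤ τs := hτqI.2.trans (by nlinarith)
  -- the crossing parameter and state
  have hσI : τq / τs ∈ Icc T₁ T₂ :=
    ⟨(le_div_iff₀ hτs).mpr hτqI.1, (div_le_iff₀ hτs).mpr hτqI.2⟩
  have he : ‖IccExtend zero_le_one P (τq / τs) - IccExtend zero_le_one (xb 0 zq) (τq / τs)‖ ≤ r₁ :=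
    (norm_IccExtend_sub_le P (xb 0 zq) _).trans hPr
  have hxL : |ω 1 * fE (IccExtend zero_le_one P (τq / τs)) i₀ 1| = L := hτqL
  have hS := hsec (τq / τs) hσI (IccExtend zero_le_one P (τq / τs)) he hxL
  refine ⟨τq, x, hτq0, hτqs, by rw [hτqL]; exact hasL, fun i k hk1 hk2 => ⟨?_, fun t ht => ⟨?_, ?_⟩⟩,
    ?_, ?_⟩
  · -- entry value
    rw [hO.1 i k, hfE1 _ i k ⟨hk1, hk2⟩, hzq]
    field_simp [(hω k).ne']
  · exact hO.2.1 τq hτqs i k hk1 hk2 t ht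
  · -- in-bounds margin
    have h1 := hnear i k t
    have h2 := hmarg (t / τs) i k hk1 hk2
    have h3 := abs_sub_abs_le_abs_sub (x i k t)
      (ω k * fE (IccExtend zero_le_one (xb 0 zq) (t / τs)) i k)
    have h4 : |ω k * fE (IccExtend zero_le_one (xb 0 zq) (t / τs)) i k| =
        ω k * |fE (IccExtend zero_le_one (xb 0 zq) (t / τs)) i k| := by
      rw [abs_mul, abs_of_pos (hω k)]
    linarith
  · -- exit and landing at the crossing state
    rw [hτqL]
    exact hS
  · -- the tube
    exact tube_of_nk α hω fE hfE1 hfE0 Q hQ hQc xb G G' A hG NK hNK hτs hr hZ1 hp hκ hKa hKb hPr x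
      (fun i n s' => rfl) htube hτqs

end RadiiGlueR

end Summit.NavierStokesRegularity.NavierStokesRegularity.Theorems

end
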